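import Literature.NumberTheory.DiophantineGeometry.GenEllDePoint
import Literature.NumberTheory.DiophantineGeometry.GenEllImagePoints
import Mathlib.FieldTheory.PrimitiveElement
import Mathlib.FieldTheory.SplittingField.Construction
import HarnessLib

/-!
# [GenEll] Thm 2.1 for `ℙ¹` (W9 assembly, piece 1): the field of the mechanism point

Support construction for the cell's number-field-only architecture of `GenEllTwo` (stmt-ABC-19679;
S. Mochizuki, *Arithmetic elliptic curves in general position*, Math. J. Okayama Univ. **52** (2010),
Thm. 2.1 (ii) ⇒ (i), proof p. 12: «every point of `U_X(ℚ̄)^{≤d}` lifts to a point of `U_Y(ℚ̄)^{≤d′}`,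
`d′ = d·deg(Y/X)`»; package map `GENELLTWO-P1ROUTE.md` of seat abc-iut-S6, §2 (A) and §4, and the
owner's W9 assignment «GenEllMechanismAssembly» (STATUS 2026-08-26T02:02:38Z): the hmech producer).

The bookkeeping theorem `vojtaIneq_of_belyi_mechanism` (p414036) wants, for each point `P = (F, x)`,
ONE number field over which the cover point `Q P = (x, r)` (`r^e = x(1−x)`), the value
`t_c(Q P)`, its image `ρ_T(t_c(Q P))` and the finite set `B = ρ_T⁻¹{0,1,∞} ∖ {∞}` are all defined —
the W5 kernel junction (w5-d045, p417377) is stated over a number field `L ⊇ K` CONTAINING `B`.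
This file constructs that field uniformly in `P`:

* `exists_irreducible_splits m₀` — for a polynomial `m₀ ∈ ℚ[X]` there is ONE irreducible monic
  `μ ∈ ℚ[X]` (the minimal polynomial of a primitive element of the splitting field of `m₀`) such that
  `m₀` splits over every field containing a root of `μ`;
* `P.mechField e μ := F(r)[Y]/(μ₁)` for an irreducible factor `μ₁` of `μ` over `F(r) = P.deField e`
  (Mathlib `AdjoinRoot`, exactly as w5-d015's `deField`): a number field, an algebra over `F(r)` and
  over `F`, of degree `≤ deg μ · e · [F:ℚ]` (`degree_mechPoint_le`), containing a root `P.mechTheta`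
  of `μ` (`aeval_mechTheta`) which generates it over `F(r)` (`adjoin_mechTheta`);
* `P.mechPoint e μ : NFPoint := (P.mechField e μ, x)` — the SAME point of `ℙ¹` («`Q P`» presented
  over the big field), with `P.mechRoot e μ = r`, `r^e = x(1−x)` (`mechRoot_pow`), `ht` unchanged
  (`ht_mechPoint`), `InU` unchanged, and `log-diff(F(r)) ≤ log-diff(mechField)` (tower monotonicity).

The `Field`/`NumberField`/`Algebra` structures on `P.mechField e μ` are Mathlib's `AdjoinRoot`
instances (the irreducibility `Fact` and the `NumberField` instance are registered for this NEW type
only; nothing existing is overridden).  Classical; nothing here bears on [IUTchIII] Cor. 3.12.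
-/

noncomputable section

open Polynomial NumberField

namespace Literature.NumberTheory.DiophantineGeometry.GenEll

/-! ## One irreducible polynomial whose root fields split a given polynomial -/

/-- **Splitting through a primitive element.** For `m₀ ∈ ℚ[X]` there is an irreducible monic
`μ ∈ ℚ[X]` such that `m₀` splits over every `ℚ`-algebra field containing a root of `μ`: take `μ` the
minimal polynomial of a primitive element `θ` of the splitting field `M` of `m₀`; a root `θ'` of `μ`
in `L` gives `M = ℚ(θ) ≅ ℚ[X]/(μ) → L`. (The finite set `B ⊂ ℚ̄` of [GenEll] p. 12 lives in one
number field.) [cite: MochizukiGenEll2010, Thm 2.1 proof p.12] -/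
theorem exists_irreducible_splits (m₀ : ℚ[X]) :
    ∃ μ : ℚ[X], Irreducible μ ∧ μ.Monic ∧
      ∀ (L : Type) [Field L] [Algebra ℚ L] (θ : L), aeval θ μ = 0 →
        (m₀.map (algebraMap ℚ L)).Splits := by
  let M := m₀.SplittingField
  obtain ⟨θ, hθ⟩ := Field.exists_primitive_element ℚ M
  have hint : IsIntegral ℚ θ := Algebra.IsIntegral.isIntegral θ
  refine ⟨minpoly ℚ θ, minpoly.irreducible hint, minpoly.monic hint, fun L _ _ θ' hθ' => ?_⟩
  -- the embedding `M = ℚ(θ) ≅ ℚ[X]/(μ) → L`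
  have hev : (minpoly ℚ θ).eval₂ (Algebra.ofId ℚ L).toRingHom θ' = 0 := by
    rw [aeval_def] at hθ'
    exact hθ'
  let φ₁ : AdjoinRoot (minpoly ℚ θ) →ₐ[ℚ] L :=
    AdjoinRoot.liftAlgHom (minpoly ℚ θ) (Algebra.ofId ℚ L) θ' hev
  let φ₂ : M ≃ₐ[ℚ] AdjoinRoot (minpoly ℚ θ) :=
    (IntermediateField.topEquiv.symm.trans (IntermediateField.equivOfEq hθ.symm)).trans
      (IntermediateField.adjoinRootEquivAdjoin ℚ hint).symm
  exact (SplittingField.splits m₀).of_algHom (φ₁.comp φ₂.toAlgHom)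

namespace NFPoint

variable (P : NFPoint) (e : ℕ) (μ : ℚ[X])

/-! ## The field `F(r)(θ)` -/

/-- An irreducible factor `μ₁` over `F(r)` of the fixed polynomial `μ ∈ ℚ[X]` (Mathlib
`Polynomial.factor`). [cite: MochizukiGenEll2010, Thm 2.1 proof p.12, P1ROUTE §2 (A)] -/
def mechFactor : (P.deField e)[X] := (μ.map (algebraMap ℚ (P.deField e))).factor

/-- `μ₁` is irreducible. [cite: MochizukiGenEll2010, Thm 2.1 proof p.12, P1ROUTE §2 (A)] -/
theorem irreducible_mechFactor : Irreducible (P.mechFactor e μ) := irreducible_factor _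

/-- The irreducibility of `μ₁` as a `Fact` instance (needed for the field structure on
`F(r)[Y]/(μ₁)`; registered for this new polynomial only).
[cite: MochizukiGenEll2010, Thm 2.1 proof p.12, P1ROUTE §2 (A)] -/
instance fact_irreducible_mechFactor : Fact (Irreducible (P.mechFactor e μ)) :=
  ⟨irreducible_mechFactor P e μ⟩

/-- `μ₁ ∣ μ` over `F(r)` (for `μ` of positive degree).
[cite: MochizukiGenEll2010, Thm 2.1 proof p.12, P1ROUTE §2 (A)] -/
theorem mechFactor_dvd (hμ : μ.natDegree ≠ 0) :
    P.mechFactor e μ ∣ μ.map (algebraMap ℚ (P.deField e)) :=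
  factor_dvd_of_natDegree_ne_zero (by rwa [natDegree_map])

/-- **The field `F(r)(θ) = F(r)[Y]/(μ₁)`** over which the mechanism's cover point, its `t_c`-value,
its image under `ρ_T` and the cusp fibre `B` are all defined (Mathlib `AdjoinRoot`; a field since
`μ₁` is irreducible). [cite: MochizukiGenEll2010, Thm 2.1 proof p.12 («Y(ℚ̄)^{≤d′}»), P1ROUTE §4] -/
abbrev mechField : Type := AdjoinRoot (P.mechFactor e μ)

/-- `F(r)(θ)` is finite over `F(r)` (power basis).
[cite: MochizukiGenEll2010, Thm 2.1 proof p.12, P1ROUTE §2 (A)] -/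
instance mechField_moduleFinite : Module.Finite (P.deField e) (P.mechField e μ) :=
  (AdjoinRoot.powerBasis (irreducible_mechFactor P e μ).ne_zero).finite

/-- `F(r)(θ)` is a number field (finite over the number field `F(r)`).
[cite: MochizukiGenEll2010, Thm 2.1 proof p.12, P1ROUTE §2 (A)] -/
instance mechField_numberField : NumberField (P.mechField e μ) :=
  NumberField.of_module_finite (P.deField e) _

/-- **The root `θ ∈ F(r)(θ)`** (the class of `Y`). [cite: MochizukiGenEll2010, Thm 2.1 proof p.12, P1ROUTE §4] -/
def mechTheta : P.mechField e μ := AdjoinRoot.root (P.mechFactor e μ)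

/-- **`μ(θ) = 0`** (for `μ` of positive degree): `θ` is a root of `μ₁`, hence of `μ`.
[cite: MochizukiGenEll2010, Thm 2.1 proof p.12, P1ROUTE §4] -/
theorem aeval_mechTheta (hμ : μ.natDegree ≠ 0) : aeval (P.mechTheta e μ) μ = 0 := by
  have h : aeval (P.mechTheta e μ) (μ.map (algebraMap ℚ (P.deField e))) = 0 := by
    rw [mechTheta, AdjoinRoot.aeval_eq, AdjoinRoot.mk_eq_zero]
    exact P.mechFactor_dvd e μ hμ
  rwa [aeval_map_algebraMap] at h

/-- **`F(r)(θ)` is generated by `θ` over `F(r)`**: `IntermediateField.adjoin F(r) {θ} = ⊤`.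
[cite: MochizukiGenEll2010, Thm 2.1 proof p.12, P1ROUTE §4] -/
theorem adjoin_mechTheta :
    IntermediateField.adjoin (P.deField e) ({P.mechTheta e μ} : Set (P.mechField e μ)) = ⊤ := by
  have halg : IsAlgebraic (P.deField e) (P.mechTheta e μ) := Algebra.IsAlgebraic.isAlgebraic _
  apply IntermediateField.toSubalgebra_injective
  rw [IntermediateField.adjoin_simple_toSubalgebra_of_isAlgebraic halg,
    IntermediateField.top_toSubalgebra]
  exact AdjoinRoot.adjoinRoot_eq_top

/-- `[F(r)(θ) : F(r)] ≤ deg μ`. [cite: MochizukiGenEll2010, Thm 2.1 proof p.12 (d′ = d·deg), P1ROUTE §4] -/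
theorem finrank_mechField_le (hμ : μ.natDegree ≠ 0) :
    Module.finrank (P.deField e) (P.mechField e μ) ≤ μ.natDegree := by
  rw [(AdjoinRoot.powerBasis (irreducible_mechFactor P e μ).ne_zero).finrank,
    AdjoinRoot.powerBasis_dim]
  have hμ0 : μ ≠ 0 := fun h => hμ (by rw [h, natDegree_zero])
  have h0 : μ.map (algebraMap ℚ (P.deField e)) ≠ 0 :=
    (Polynomial.map_ne_zero_iff (algebraMap ℚ (P.deField e)).injective).mpr hμ0
  calc (P.mechFactor e μ).natDegree ≤ (μ.map (algebraMap ℚ (P.deField e))).natDegree :=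
        natDegree_le_of_dvd (P.mechFactor_dvd e μ hμ) h0
    _ = μ.natDegree := natDegree_map _

/-! ## The mechanism point `(F(r)(θ), x)` and the root `r` in the big field -/

/-- **The point `x` presented over `F(r)(θ)`** («`Q P`» of the W9 assembly in the W5 junction's
currency: the same point of `ℙ¹`, over the field containing `r`, `θ` and the cusp fibre `B`).  An
`abbrev`, so that `(P.mechPoint e μ).F` is `P.mechField e μ` by `rfl`.
[cite: MochizukiGenEll2010, Thm 2.1 proof p.12 («every point of U_X(ℚ̄)^{≤d} lifts to U_Y(ℚ̄)^{≤d′}»), P1ROUTE §4] -/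
abbrev mechPoint : NFPoint := ⟨P.mechField e μ, algebraMap P.F (P.mechField e μ) P.x⟩

/-- The presenting field of `P.mechPoint e μ` is `F(r)(θ)`. [cite: MochizukiGenEll2010, Thm 2.1 proof p.12, P1ROUTE §4] -/
theorem mechPoint_F : (P.mechPoint e μ).F = P.mechField e μ := rfl

/-- The coordinate of `P.mechPoint e μ` is `x` (viewed in `F(r)(θ)`). [cite: MochizukiGenEll2010, Thm 2.1 proof p.12, P1ROUTE §4] -/
theorem mechPoint_x : (P.mechPoint e μ).x = algebraMap P.F (P.mechField e μ) P.x := rfl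

/-- The tower `F → F(r) → F(r)(θ)`: the structure map of `F(r)(θ)` over `F` factors through `F(r)`.
[cite: MochizukiGenEll2010, Thm 2.1 proof p.12, P1ROUTE §4] -/
theorem algebraMap_mechField_eq :
    algebraMap P.F (P.mechField e μ) =
      (algebraMap (P.deField e) (P.mechField e μ)).comp (algebraMap P.F (P.deField e)) :=
  IsScalarTower.algebraMap_eq P.F (P.deField e) (P.mechField e μ)

/-- The coordinate of `P.mechPoint e μ` is the image of the coordinate of `P.dePoint e`.
[cite: MochizukiGenEll2010, Thm 2.1 proof p.12, P1ROUTE §4] -/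
theorem mechPoint_x_eq_map_dePoint_x :
    (P.mechPoint e μ).x = algebraMap (P.deField e) (P.mechField e μ) (P.dePoint e).x := by
  rw [mechPoint_x, algebraMap_mechField_eq, RingHom.comp_apply, dePoint_x]

/-- **The root `r ∈ F(r)(θ)`** (the image of `P.deRoot e`). [cite: MochizukiGenEll2010, Thm 2.1 proof p.12, P1ROUTE §2 (A)] -/
def mechRoot : P.mechField e μ := algebraMap (P.deField e) (P.mechField e μ) (P.deRoot e)

/-- **`r^e = x(1−x)`** in `F(r)(θ)` (for `e ≥ 1`). [cite: MochizukiGenEll2010, Thm 2.1 proof p.12, P1ROUTE §2 (A)] -/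
theorem mechRoot_pow (he : 0 < e) :
    P.mechRoot e μ ^ e = (P.mechPoint e μ).x * (1 - (P.mechPoint e μ).x) := by
  rw [mechRoot, ← map_pow, P.deRoot_pow e he, mechPoint_x, algebraMap_mechField_eq,
    RingHom.comp_apply, map_mul, map_sub, map_one, map_mul, map_sub, map_one]

/-- `P.mechPoint e μ` lies in `U = ℙ¹ ∖ {0,1,∞}` iff `P` does. [cite: MochizukiGenEll2010, Thm 2.1 (ii) p.11 (U_P), P1ROUTE §4] -/
theorem inU_mechPoint_iff : (P.mechPoint e μ).InU ↔ P.InU := by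
  simp only [InU, ne_eq, map_eq_zero_iff _ (algebraMap P.F (P.mechField e μ)).injective]
  rw [← (algebraMap P.F (P.mechField e μ)).map_one,
    (algebraMap P.F (P.mechField e μ)).injective.eq_iff]

/-- `r ≠ 0` in `F(r)(θ)` when `x ∈ U`. [cite: MochizukiGenEll2010, Thm 2.1 proof p.12, P1ROUTE §2 (A)] -/
theorem mechRoot_ne_zero (hP : P.InU) (he : 0 < e) : P.mechRoot e μ ≠ 0 := by
  intro h0
  have hU : (P.mechPoint e μ).InU := (P.inU_mechPoint_iff e μ).mpr hP
  have h := P.mechRoot_pow e μ he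
  rw [h0, zero_pow he.ne'] at h
  rcases mul_eq_zero.mp h.symm with h1 | h1
  · exact hU.1 h1
  · exact hU.2 (by rwa [sub_eq_zero, eq_comm] at h1)

/-- `1 − 2x ≠ 0` in `F(r)(θ)` iff `1 − 2x ≠ 0` in `F` (the Weierstrass fibre `x = 1/2` is the same).
[cite: MochizukiGenEll2010, Thm 2.1 proof p.12, P1ROUTE §2 (B)] -/
theorem one_sub_two_mul_mechPoint_x_ne_zero_iff :
    1 - 2 * (P.mechPoint e μ).x ≠ 0 ↔ 1 - 2 * P.x ≠ 0 := by
  have h : 1 - 2 * (P.mechPoint e μ).x = algebraMap P.F (P.mechField e μ) (1 - 2 * P.x) := by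
    rw [mechPoint_x, map_sub, map_one, map_mul, map_ofNat]
  rw [h, map_ne_zero_iff _ (algebraMap P.F (P.mechField e μ)).injective]

/-- **Degree bound**: `[F(r)(θ) : ℚ] ≤ deg μ · (e · [F : ℚ])` (the «`d′ = d·deg(Y/X)`» of
[GenEll] p. 12, times the degree of the fixed field `ℚ(θ)`).
[cite: MochizukiGenEll2010, Thm 2.1 proof p.12, P1ROUTE §4] -/
theorem degree_mechPoint_le (he : 0 < e) (hμ : μ.natDegree ≠ 0) :
    (P.mechPoint e μ).degree ≤ μ.natDegree * (e * P.degree) := by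
  have h1 : (P.mechPoint e μ).degree =
      Module.finrank (P.deField e) (P.mechField e μ) * (P.dePoint e).degree := by
    unfold degree
    change Module.finrank ℚ (P.mechField e μ) =
      Module.finrank (P.deField e) (P.mechField e μ) * Module.finrank ℚ (P.deField e)
    rw [mul_comm, Module.finrank_mul_finrank ℚ (P.deField e) (P.mechField e μ)]
  rw [h1]
  exact Nat.mul_le_mul (P.finrank_mechField_le e μ hμ) (P.degree_dePoint_le e he)

/-- `P.mechPoint e μ` has degree `≤ d′` whenever `P` has degree `≤ d` and `deg μ · e · d ≤ d′`.
[cite: MochizukiGenEll2010, Thm 2.1 proof p.12, P1ROUTE §4] -/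
theorem degree_mechPoint_le_of_le (he : 0 < e) (hμ : μ.natDegree ≠ 0) {d d' : ℕ}
    (hd : P.degree ≤ d) (hd' : μ.natDegree * (e * d) ≤ d') : (P.mechPoint e μ).degree ≤ d' :=
  (P.degree_mechPoint_le e μ he hμ).trans
    ((Nat.mul_le_mul_left _ (Nat.mul_le_mul_left e hd)).trans hd')

/-- **The normalised height is unchanged**: `ht(F(r)(θ), x) = ht(F, x)` (independence of the
absolute height of the presenting field, via `NumberField.logHeight₁_map_ringHom`).
[cite: MochizukiGenEll2010, Def 1.2 (i) p.5 (heights), P1ROUTE §3 (b)] -/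
theorem ht_mechPoint : (P.mechPoint e μ).ht = P.ht := by
  have h := NumberField.logHeight₁_map_ringHom (algebraMap P.F (P.mechField e μ)) P.x
  have hQ : (0 : ℝ) < (P.mechPoint e μ).degree := Nat.cast_pos.mpr (P.mechPoint e μ).degree_pos
  have hP : (0 : ℝ) < P.degree := Nat.cast_pos.mpr P.degree_pos
  unfold ht
  change ((P.mechPoint e μ).degree : ℝ)⁻¹ *
      Height.logHeight₁ (algebraMap P.F (P.mechField e μ) P.x) =
    (P.degree : ℝ)⁻¹ * Height.logHeight₁ P.x
  change (P.degree : ℝ) * Height.logHeight₁ (algebraMap P.F (P.mechField e μ) P.x) =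
    ((P.mechPoint e μ).degree : ℝ) * Height.logHeight₁ P.x at h
  field_simp
  linarith

/-- The normalised height of `x` over `F(r)(θ)`, Weil form: `(1/[F(r)(θ):ℚ])·h(x) = ht(P)`.
[cite: MochizukiGenEll2010, Def 1.2 (i) p.5, P1ROUTE §3 (b)] -/
theorem inv_finrank_mul_logHeight₁_mechPoint :
    (Module.finrank ℚ (P.mechField e μ) : ℝ)⁻¹ * Height.logHeight₁ (P.mechPoint e μ).x = P.ht :=
  P.ht_mechPoint e μ

/-- `log-diff` does not decrease from `P.dePoint e` to `P.mechPoint e μ` (`F(r) ⊆ F(r)(θ)`).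
[cite: MochizukiGenEll2010, Prop 1.7 (i) p.10 (left inequality, constant 0), P1ROUTE §3 (c)] -/
theorem logDiff_dePoint_le_logDiff_mechPoint : (P.dePoint e).logDiff ≤ (P.mechPoint e μ).logDiff :=
  logDiff_le_logDiff_of_ringHom (P.dePoint e) (P.mechPoint e μ)
    (algebraMap (P.deField e) (P.mechField e μ))

/-- `log-diff` does not decrease from `P` to `P.mechPoint e μ` (`F ⊆ F(r)(θ)`).
[cite: MochizukiGenEll2010, Prop 1.7 (i) p.10 (left inequality, constant 0), P1ROUTE §3 (c)] -/
theorem logDiff_le_logDiff_mechPoint : P.logDiff ≤ (P.mechPoint e μ).logDiff :=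
  logDiff_le_logDiff_of_ringHom P (P.mechPoint e μ) (algebraMap P.F (P.mechField e μ))

/-- **Every root field of `μ` maps to `F(r)(θ)`**: for `μ` of positive degree, any polynomial that
splits over every field containing a root of `μ` splits over `F(r)(θ)` (so the cusp fibre
`B = roots(p·q·(p−q))` and the field of the critical values lie in `F(r)(θ)`).
[cite: MochizukiGenEll2010, Thm 2.1 proof p.12, P1ROUTE §4] -/
theorem splits_mechField (hμ : μ.natDegree ≠ 0) {m₀ : ℚ[X]}
    (hsplit : ∀ (L : Type) [Field L] [Algebra ℚ L] (θ : L), aeval θ μ = 0 →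
      (m₀.map (algebraMap ℚ L)).Splits) :
    (m₀.map (algebraMap ℚ (P.mechField e μ))).Splits :=
  hsplit (P.mechField e μ) (P.mechTheta e μ) (P.aeval_mechTheta e μ hμ)

end NFPoint

end Literature.NumberTheory.DiophantineGeometry.GenEll

end
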